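import Literature.AlgebraicGeometry.Frobenioids.ArchimedeanAngularModel
import Literature.AlgebraicGeometry.Frobenioids.ArchimedeanIsotropyPropagation
import Literature.AlgebraicGeometry.Frobenioids.FiniteEtaleBase
import Mathlib.NumberTheory.PrimeCounting
import HarnessLib

/-!
# Frobenioids II, towards Proposition 3.5 (iv): isotropic objects of `C = C₀ ×_{D₀} D` are not anchors
# ([FrdI] Prop. 1.10 (iv) / Def. 1.3 (vii)(b) made explicit for the archimedean Frobenioid)

Mochizuki, *The geometry of Frobenioids II*, Kyushu J. Math. **62** (2008) 401–460, §3, Prop. 3.5 (iv) and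
its proof, kurims text pp. 34–36 [cite: MochizukiFrdII2008, Prop 3.5 (iv) p.34]: "`F` is not of
RC-iso-subanchor type" — "… hence `F` admits a complex isotropic RC-anchor `C`, i.e. …" a contradiction.
The two ingredients of that contradiction, proved here directly from the explicit structure of Example
3.3 (i) (no appeal to the unproved `ArchFrd.Ex33ii_isFrobenioid`):

* **[FrdI] Def. 1.3 (vii)(b) for `C`** — an arrow out of an object with (naively) isotropic angular region
  has (naively) isotropic codomain: abc-iut-L1-t6's `C0.isNaivelyIsotropic_of_hom`
  (`ArchimedeanIsotropyPropagation.lean`), used by name;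
* **isotropic objects are never anchors** ([FrdI] Prop. 1.10 (iv), Rmk. 3.1.1 "an anchor is never
  isotropic"): for a naively isotropic `X` and a prime `p`, the Frobenius-type arrow
  `((id, p, 1), id) : X → X^{(p)}` onto the isotropic region of tip `tip(X)^p` is IRREDUCIBLE in `C` (and in
  the full subcategory `C[ℂ]`) when `D` is totally epimorphic (Ex. 3.3's standing hypothesis) — any
  factorization has a degree-one factor, which is an isometric pre-step out of an isotropic object, hence
  an isomorphism by Ex. 3.3 (ii) (abc-iut-L1-t6) — and arrows of distinct prime degrees give
  non-isomorphic objects under `X`; so a complex isotropic object is not an anchor of `C[ℂ]`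
  (`not_isAnchor_complexPart_of_isotropic`).

Everything is PROVED; no statement of the paper is strengthened; nothing here bears on [IUTchIII].
-/

namespace Literature.AlgebraicGeometry.Frobenioids

open CategoryTheory
open scoped Pointwise

noncomputable section

universe v u

namespace ArchFrd

variable {D : Type u} [Category.{v} D] (π : D ⥤ D0)

/-! ### Frobenius-type arrows of prime degree out of isotropic objects -/

/-- `X^{(n)}`: the same base data with the isotropic angular region of tip `tip(X)^n`.
[cite: MochizukiFrdII2008, Ex 3.3 (ii) p.28] -/
abbrev frobObj (X : C π) (n : ℕ) : C π :=
  ⟨⟨X.fst.base, AngularRegion.isotropicOfTip (X.fst.region.tip ^ n),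
    fun _ => AngularRegion.isIsotropic_isotropicOfTip _⟩, X.snd, X.iso⟩

/-- The tip of `X^{(n)}` is `tip(X)^n`. [cite: MochizukiFrdII2008, Ex 3.3 (ii) p.28] -/
theorem tip_frobObj (X : C π) (n : ℕ) : (frobObj π X n).fst.tip = X.fst.tip ^ n := by
  change (((X.fst.region.tip ^ n : PosReal)) : ℝ) = _
  rw [Positive.val_pow]; rfl

/-- The Frobenius-type arrow `((id, n, 1), id) : X → X^{(n)}` for a naively isotropic `X`.
[cite: MochizukiFrdII2008, Ex 3.3 (ii) p.28] -/
def frobHom (X : C π) (n : ℕ+) : X ⟶ frobObj π X n where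
  fst := C0.homOfNorm X.fst (frobObj π X n).fst (𝟙 X.fst.base) n 1 (one_mem _)
    (AngularRegion.isIsotropic_isotropicOfTip _) (by rw [Units.val_one, norm_one, one_mul, tip_frobObj])
  snd := 𝟙 X.snd
  w := by
    change 𝟙 _ ≫ X.iso.hom = X.iso.hom ≫ π.map (𝟙 X.snd)
    rw [CategoryTheory.Functor.map_id, Category.id_comp, Category.comp_id]

/-- The degree of a Frobenius-type arrow. [cite: MochizukiFrdII2008, Ex 3.3 (ii) p.28] -/
theorem degFr_frobHom (X : C π) (n : ℕ+) : C0.degFr (frobHom π X n).fst = n := rfl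

/-- An isomorphism of `C` has Frobenius degree `1`. [cite: MochizukiFrdII2008, Ex 3.3 (i) p.27] -/
theorem degFr_eq_one_of_isIso {X Y : C π} (φ : X ⟶ Y) [IsIso φ] : C0.degFr φ.fst = 1 := by
  have h := congrArg (fun k => (C0.degFr k.fst : ℕ)) (IsIso.hom_inv_id φ)
  simp only [CFP.comp_fst, C0.degFr_comp', PNat.mul_coe] at h
  change _ = ((1 : ℕ+) : ℕ) at h
  exact PNat.coe_inj.1 (Nat.eq_one_of_mul_eq_one_right h)

/-- A Frobenius-type arrow of degree `n ≠ 1` is not an isomorphism. [cite: MochizukiFrdII2008, Ex 3.3 (ii) p.28] -/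
theorem not_isIso_frobHom (X : C π) (n : ℕ+) (hn : n ≠ 1) :
    ¬ IsIso (frobHom π X n) := fun _ => hn (degFr_eq_one_of_isIso π (frobHom π X n))

/-- An isometric pre-step of `C` out of an object with naively isotropic region is an isomorphism
(Ex. 3.3 (ii), abc-iut-L1-t6, unpacked). [cite: MochizukiFrdII2008, Ex 3.3 (ii) p.28] -/
theorem isIso_of_isometric_preStep {X Y : C π} (hX : X.fst.IsNaivelyIsotropic) (φ : X ⟶ Y)
    (hd : C0.degFr φ.fst = 1) [IsIso φ.snd]
    (hn : ‖(C0.scalar φ.fst : ℂ)‖ * X.fst.tip ^ (C0.degFr φ.fst : ℕ) = Y.fst.tip) : IsIso φ := by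
  have hiso : PreFrobenioid.IsIsometry (C.toElem π) φ := by
    have h : PreFrobenioid.IsIsometry C0.toElem φ.fst := (A0.isIsometry_iff_norm_mul_tip_pow φ.fst).2 hn
    exact h
  have hpre : PreFrobenioid.IsPreStep (C.toElem π) φ := ⟨hd, (inferInstance : IsIso φ.snd)⟩
  exact (Ex33ii_isotropic_iff_holds π X).2 hX φ hiso hpre

/-- **Frobenius-type arrows of prime degree out of isotropic objects are irreducible** (for `D` totally
epimorphic): in a factorization `X → W → X^{(p)}` the `D`-components are isomorphisms, one factor has
degree `1`, and the tip inequalities `|c| · tip^d ≤ tip'` force that factor to be an isometric pre-step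
out of an isotropic object, hence an isomorphism. [cite: MochizukiFrdII2008, Prop 3.5 (iv) p.34] -/
theorem isIso_or_isIso_of_fac_frobHom (hTE : IsTotallyEpimorphic D) {X W : C π}
    (hX : X.fst.IsNaivelyIsotropic) (p : ℕ+) (hp : (p : ℕ).Prime) (β : X ⟶ W) (α : W ⟶ frobObj π X p)
    (h : β ≫ α = frobHom π X p) : IsIso α ∨ IsIso β := by
  -- `D`-components
  have hsnd : β.snd ≫ α.snd = 𝟙 X.snd := congrArg CFP.Hom.snd h
  haveI : IsSplitMono β.snd := IsSplitMono.mk' ⟨α.snd, hsnd⟩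
  haveI : Epi β.snd := hTE.epi β.snd
  haveI : IsIso β.snd := isIso_of_epi_of_isSplitMono β.snd
  haveI : IsIso (β.snd ≫ α.snd) := by rw [hsnd]; infer_instance
  haveI : IsIso α.snd := IsIso.of_isIso_comp_left β.snd α.snd
  -- degrees and norms
  have hW : W.fst.IsNaivelyIsotropic := C0.isNaivelyIsotropic_of_hom β.fst hX
  have hdeg : (C0.degFr β.fst : ℕ) * C0.degFr α.fst = p := by
    have e := congrArg (fun k => (C0.degFr k.fst : ℕ)) h
    simp only [CFP.comp_fst, C0.degFr_comp', PNat.mul_coe] at e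
    exact e
  have hsc : ‖(C0.scalar α.fst : ℂ)‖ * ‖(C0.scalar β.fst : ℂ)‖ ^ (C0.degFr α.fst : ℕ) = 1 := by
    have e := congrArg (fun k => ‖((C0.scalar k.fst : ℂˣ) : ℂ)‖) h
    simp only [CFP.comp_fst, C0.scalar_comp'] at e
    rw [Units.val_mul, norm_mul, Units.val_pow_eq_pow_val, norm_pow, D0.norm_galAct] at e
    rw [e]
    change ‖((1 : ℂˣ) : ℂ)‖ = 1
    rw [Units.val_one, norm_one]
  have hβle := C0.norm_scalar_mul_tip_pow_le β.fst   -- |c_β| t^{d_β} ≤ u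
  have hαle := C0.norm_scalar_mul_tip_pow_le α.fst   -- |c_α| u^{d_α} ≤ t^p
  rw [tip_frobObj] at hαle
  have ht : 0 < X.fst.tip := X.fst.tip_pos
  have hu : 0 < W.fst.tip := W.fst.tip_pos
  have hcβ : 0 < ‖(C0.scalar β.fst : ℂ)‖ := norm_pos_iff.mpr (C0.scalar β.fst).ne_zero
  have hcα : 0 < ‖(C0.scalar α.fst : ℂ)‖ := norm_pos_iff.mpr (C0.scalar α.fst).ne_zero
  rcases hp.eq_one_or_self_of_dvd _ (Dvd.intro _ hdeg) with hb1 | hbp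
  · -- `deg β = 1`, `deg α = p`: `β` is an isometric pre-step out of the isotropic `X`
    right
    have hb1' : C0.degFr β.fst = 1 := PNat.coe_inj.1 hb1
    have hap : (C0.degFr α.fst : ℕ) = p := by rw [hb1, one_mul] at hdeg; exact hdeg
    rw [hb1, pow_one] at hβle
    rw [hap] at hαle hsc
    -- `u^p ≤ t^p / |c_α| = (|c_β| t)^p`, so `u ≤ |c_β| t`
    have hup : W.fst.tip ^ (p : ℕ) ≤ (‖(C0.scalar β.fst : ℂ)‖ * X.fst.tip) ^ (p : ℕ) := by
      rw [mul_pow]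
      have e : ‖(C0.scalar β.fst : ℂ)‖ ^ (p : ℕ) = ‖(C0.scalar α.fst : ℂ)‖⁻¹ :=
        eq_inv_of_mul_eq_one_right hsc
      rw [e, ← div_eq_inv_mul, le_div_iff₀ hcα, mul_comm]
      exact hαle
    have hule : W.fst.tip ≤ ‖(C0.scalar β.fst : ℂ)‖ * X.fst.tip :=
      le_of_pow_le_pow_left₀ p.ne_zero (mul_pos hcβ ht).le hup
    refine isIso_of_isometric_preStep π hX β hb1' ?_
    rw [hb1', PNat.one_coe, pow_one]
    exact le_antisymm hβle hule
  · -- `deg β = p`, `deg α = 1`: `α` is an isometric pre-step out of the isotropic `W`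
    left
    have ha1 : (C0.degFr α.fst : ℕ) = 1 := by
      rw [hbp] at hdeg
      exact (Nat.mul_right_inj hp.ne_zero).1 (hdeg.trans (mul_one _).symm)
    have ha1' : C0.degFr α.fst = 1 := PNat.coe_inj.1 ha1
    rw [hbp] at hβle
    rw [ha1, pow_one] at hαle hsc
    -- `t^p ≤ u / |c_β| = |c_α| u`
    have hle : X.fst.tip ^ (p : ℕ) ≤ ‖(C0.scalar α.fst : ℂ)‖ * W.fst.tip := by
      have e : ‖(C0.scalar α.fst : ℂ)‖ = ‖(C0.scalar β.fst : ℂ)‖⁻¹ :=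
        eq_inv_of_mul_eq_one_left hsc
      rw [e, ← div_eq_inv_mul, le_div_iff₀ hcβ, mul_comm]
      exact hβle
    refine isIso_of_isometric_preStep π hW α ha1' ?_
    rw [ha1', PNat.one_coe, pow_one, tip_frobObj]
    exact le_antisymm hαle hle

/-- **Irreducibility in `C`** of the prime-degree Frobenius-type arrows out of isotropic objects.
[cite: MochizukiFrdII2008, Prop 3.5 (iv) p.34] -/
theorem isIrreducibleHom_frobHom (hTE : IsTotallyEpimorphic D) (X : C π) (hX : X.fst.IsNaivelyIsotropic)
    (p : ℕ+) (hp : (p : ℕ).Prime) : IsIrreducibleHom (frobHom π X p) :=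
  ⟨not_isIso_frobHom π X p (fun h1 => hp.ne_one (by rw [h1]; rfl)),
    fun _ β α h => isIso_or_isIso_of_fac_frobHom π hTE hX p hp β α h⟩

/-! ### The complex part `C[ℂ]` and anchors -/

/-- The functor `C → D → D₀ → ArchBase` along which "real/complex" is read ([FrdII] Def. 3.1 (v)).
[cite: MochizukiFrdII2008, Def 3.1 (v) p.24] -/
abbrev rcOf : C π ⥤ ArchBase := PreFrobenioid.baseFunctor (C.toElem π) ⋙ baseRC π

/-- In a full subcategory, an arrow whose underlying arrow is an isomorphism is an isomorphism. [folklore] -/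
private theorem isIso_of_isIso_hom {T : Type u} [Category.{v} T] {P : ObjectProperty T} {A B : P.FullSubcategory}
    (f : A ⟶ B) [IsIso f.hom] : IsIso f :=
  ⟨⟨ObjectProperty.homMk (inv f.hom), ObjectProperty.hom_ext _ (IsIso.hom_inv_id f.hom),
    ObjectProperty.hom_ext _ (IsIso.inv_hom_id f.hom)⟩⟩

/-- The Frobenius-type arrow as an arrow of the complex part `C[ℂ]` (its codomain has the same base).
[cite: MochizukiFrdII2008, Prop 3.5 (iv) p.34] -/
def frobHomC (X : C π) (hc : RC.complexObjects (rcOf π) X) (p : ℕ+) :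
    (⟨X, hc⟩ : RC.ComplexPart (rcOf π)) ⟶ ⟨frobObj π X p, hc⟩ :=
  ObjectProperty.homMk (frobHom π X p)

/-- Irreducibility of the Frobenius-type arrows inside `C[ℂ]` (fewer factorizations, same isomorphisms).
[cite: MochizukiFrdII2008, Prop 3.5 (iv) p.34] -/
theorem isIrreducibleHom_frobHomC (hTE : IsTotallyEpimorphic D) (X : C π) (hc : RC.complexObjects (rcOf π) X)
    (hX : X.fst.IsNaivelyIsotropic) (p : ℕ+) (hp : (p : ℕ).Prime) : IsIrreducibleHom (frobHomC π X hc p) := by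
  refine ⟨fun hi => ?_, fun W β α h => ?_⟩
  · haveI := hi
    haveI : IsIso ((RC.complexObjects (rcOf π)).ι.map (frobHomC π X hc p)) := inferInstance
    exact not_isIso_frobHom π X p (fun h1 => hp.ne_one (by rw [h1]; rfl))
      (this : IsIso (frobHom π X p))
  · have h' : β.hom ≫ α.hom = frobHom π X p := congrArg (fun k => k.hom) h
    rcases isIso_or_isIso_of_fac_frobHom π hTE hX p hp β.hom α.hom h' with hα | hβ
    · haveI := hα; exact Or.inl (isIso_of_isIso_hom α)
    · haveI := hβ; exact Or.inr (isIso_of_isIso_hom β)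

/-- Frobenius-type arrows of different degrees give non-isomorphic objects under `X` (degrees are
multiplicative and isomorphisms... any connecting arrow multiplies the degree).
[cite: MochizukiFrdII2008, Prop 3.5 (iv) p.34] -/
theorem eq_of_under_iso (X : C π) (hc : RC.complexObjects (rcOf π) X) {p q : ℕ+} (hp : (p : ℕ).Prime)
    (hq : (q : ℕ).Prime) (e : Under.mk (frobHomC π X hc p) ≅ Under.mk (frobHomC π X hc q)) : p = q := by
  have w := Under.w e.hom
  have hd := congrArg (fun k => (C0.degFr k.hom.fst : ℕ)) w
  change (C0.degFr ((frobHom π X p) ≫ e.hom.right.hom).fst : ℕ) = (C0.degFr (frobHom π X q).fst : ℕ) at hd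
  rw [CFP.comp_fst, C0.degFr_comp', PNat.mul_coe, degFr_frobHom, degFr_frobHom] at hd
  exact PNat.coe_inj.1 ((Nat.prime_dvd_prime_iff_eq hp hq).1 (Dvd.intro _ hd))

/-- **An object of `C` with naively isotropic region is not an anchor of `C[ℂ]`** (nor, a fortiori, an
RC-anchor): the prime-degree Frobenius-type arrows are irreducible and pairwise non-isomorphic under `X`
(`D` totally epimorphic). [cite: MochizukiFrdII2008, Prop 3.5 (iv) p.34] -/
theorem not_isAnchor_complexPart_of_isotropic (hTE : IsTotallyEpimorphic D) (X : C π)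
    (hc : RC.complexObjects (rcOf π) X) (hX : X.fst.IsNaivelyIsotropic) :
    ¬ IsAnchor (⟨X, hc⟩ : RC.ComplexPart (rcOf π)) := by
  intro hfin
  -- the classes of the Frobenius arrows of prime degree, indexed by `ℕ` via the `n`-th prime
  let P : ℕ → ℕ+ := fun n => ⟨Nat.nth Nat.Prime n, (Nat.prime_nth_prime n).pos⟩
  have hP : ∀ n, ((P n : ℕ+) : ℕ).Prime := fun n => Nat.prime_nth_prime n
  let g : ℕ → Quotient (isIsomorphicSetoid (Under (⟨X, hc⟩ : RC.ComplexPart (rcOf π)))) :=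
    fun n => Quotient.mk _ (Under.mk (frobHomC π X hc (P n)))
  have hg : Function.Injective g := by
    intro m n hmn
    obtain ⟨e⟩ := Quotient.exact hmn
    have hPmn : P m = P n := eq_of_under_iso π X hc (hP m) (hP n) e
    have : Nat.nth Nat.Prime m = Nat.nth Nat.Prime n := congrArg (fun k : ℕ+ => (k : ℕ)) hPmn
    exact Nat.nth_injective Nat.infinite_setOf_prime this
  refine Set.infinite_of_injective_forall_mem hg (fun n => ?_) hfin
  exact ⟨Under.mk (frobHomC π X hc (P n)), isIrreducibleHom_frobHomC π hTE X hc hX (P n) (hP n), rfl⟩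

end ArchFrd

end

end Literature.AlgebraicGeometry.Frobenioids
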